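import Mathlib.Probability.Moments.Variance
import Mathlib.MeasureTheory.Measure.Tilted
import HarnessLib

/-!
# Crux `FluctuationComparisonRegPrIntL` (stmt-QuantumFields-20520, rung R3), PATH-B organ, v18 (H-currency) — (TV) THE VARIANCE UNDER A TILTED MEASURE AS A RATIO
# OF THREE BASE MOMENTS, and its invariance under proportional data (generic measure theory for the (JV-rep) bridge of the Jensen knit)

Cell `ym3-torus` (YM ladder rung R3 = continuum `SU(2)` Yang–Mills on the three-torus — a RUNG: NOT d = 4, NOT infinite volume, NOT a mass gap, NOT Clay).
Width seat `ym-ust-20520-w5` (gen 23), `--supports stmt-QuantumFields-20520 --as helper`, count-neutral, no registry ∕ binder ∕ `Lines/` edit, DEFINITION-FREE,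
default heartbeats.  Mathlib only (`Measure.tilted`, `ProbabilityTheory.variance`).

* ★`variance_tilted_eq_ratio` — for a measure `μ`, measurable `h` and a tilt `f` with `e^f`, `e^f·h`, `e^f·h²` integrable:
  `Var[h; μ.tilted f] = (I₂ − 2·M·I₁ + M²·I₀) ∕ I₀`, `I_k := ∫ e^f·h^k dμ`, `M := I₁∕I₀` (Mathlib `variance_eq_integral` + `integral_tilted`; no
  probability ∕ finiteness assumption beyond the three integrabilities).
* ★`ratio_eq_of_proportional` — if `I_k = κ·C_k` (`k = 0,1,2`, `κ ≠ 0`, `C₀ ≠ 0`) the ratio of the `I`'s equals that of the `C`'s (the (A3)∕(A3′)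
  proportionality constants of a disintegration cancel in a variance).
* ★`ratio_eq_integral_centred_sq` — `(C₂ − 2mC₁ + m²C₀) ∕ C₀ = (∫ (g − m)²·w) ∕ (∫ w)` with `C_k = ∫ g^k·w`, `m = C₁∕C₀` (the chart side's centred form).

HONEST FRAMING: [folklore] bookkeeping; nothing of Bałaban's analysis is asserted or proved; JVARᵘ-H″ ∕ SpreadFibreLawH(J) ∕ O1ᵘ-H v2.x ∕ S1aᴴ ∕ 26243 ∕ S2α′ ∕ S2β
OPEN; crux 20520 `FluctuationComparisonRegPrIntL` ∕ `YM3TorusSU2` NOT proved; no summit ∕ sub-problem statement is proved; rung R3 = SU(2) YM₃ on T³ at fixed lattice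
data — NOT d = 4, NOT infinite volume, NOT a mass gap, NOT Clay; the Yang–Mills mass gap is NOT proved.
-/

set_option autoImplicit false

noncomputable section

namespace Summit.QuantumFields.YangMills.Theorems.OrganTangentTiltedVarianceRatio

open MeasureTheory ProbabilityTheory Real
open scoped ENNReal

variable {Ω : Type*} [MeasurableSpace Ω]

/-- ★ **THE VARIANCE UNDER A TILTED MEASURE AS A RATIO OF THREE BASE INTEGRALS.**  For a measure `μ`, a measurable `h` and a tilt `f` with
`e^f`, `e^f·h`, `e^f·h²` integrable: `Var[h; μ.tilted f] = (I₂ − 2·M·I₁ + M²·I₀) ∕ I₀` with `I_k := ∫ e^f·h^k dμ`, `M := I₁ ∕ I₀` (Mathlib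
`variance_eq_integral` + `integral_tilted`; no probability ∕ finiteness assumption beyond the three integrabilities). [folklore] -/
theorem variance_tilted_eq_ratio (μ : Measure Ω) {h f : Ω → ℝ} (hh : Measurable h)
    (hi₀ : Integrable (fun x => exp (f x)) μ) (hi₁ : Integrable (fun x => exp (f x) * h x) μ)
    (hi₂ : Integrable (fun x => exp (f x) * h x ^ 2) μ) :
    variance h (μ.tilted f) =
      ((∫ x, exp (f x) * h x ^ 2 ∂μ) - 2 * ((∫ x, exp (f x) * h x ∂μ) / (∫ x, exp (f x) ∂μ)) * (∫ x, exp (f x) * h x ∂μ)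
        + ((∫ x, exp (f x) * h x ∂μ) / (∫ x, exp (f x) ∂μ)) ^ 2 * (∫ x, exp (f x) ∂μ)) / (∫ x, exp (f x) ∂μ) := by
  rw [variance_eq_integral hh.aemeasurable, integral_tilted f h, integral_tilted f]
  have hM : ∫ x, (exp (f x) / ∫ y, exp (f y) ∂μ) • h x ∂μ = (∫ x, exp (f x) * h x ∂μ) / (∫ y, exp (f y) ∂μ) := by
    rw [← integral_div]
    refine integral_congr_ae (Filter.Eventually.of_forall fun x => ?_)
    simp only [smul_eq_mul]
    ring
  rw [hM]
  generalize hZ : (∫ y, exp (f y) ∂μ) = Z₀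
  have hint : ∀ x, (exp (f x) / Z₀) • (h x - (∫ x, exp (f x) * h x ∂μ) / Z₀) ^ 2
      = (exp (f x) * h x ^ 2 - 2 * ((∫ x, exp (f x) * h x ∂μ) / Z₀) * (exp (f x) * h x)
          + ((∫ x, exp (f x) * h x ∂μ) / Z₀) ^ 2 * exp (f x)) / Z₀ := by
    intro x; rw [smul_eq_mul]; ring
  have iA : Integrable (fun x => exp (f x) * h x ^ 2 - 2 * ((∫ x, exp (f x) * h x ∂μ) / Z₀) * (exp (f x) * h x)) μ :=
    hi₂.sub (hi₁.const_mul _)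
  rw [integral_congr_ae (Filter.Eventually.of_forall hint), integral_div,
    integral_add iA (hi₀.const_mul _), integral_sub hi₂ (hi₁.const_mul _), integral_const_mul, integral_const_mul, hZ]

/-- ★ **THE RATIO IS INVARIANT UNDER PROPORTIONAL DATA** (pure algebra): if `I_k = κ·C_k` (`k = 0,1,2`) with `κ ≠ 0`, then the tilted-variance ratio of the
`I`'s equals the one of the `C`'s. [folklore] -/
theorem ratio_eq_of_proportional {I₀ I₁ I₂ C₀ C₁ C₂ κ : ℝ} (hκ : κ ≠ 0) (hC₀ : C₀ ≠ 0)
    (h₀ : I₀ = κ * C₀) (h₁ : I₁ = κ * C₁) (h₂ : I₂ = κ * C₂) :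
    (I₂ - 2 * (I₁ / I₀) * I₁ + (I₁ / I₀) ^ 2 * I₀) / I₀ = (C₂ - 2 * (C₁ / C₀) * C₁ + (C₁ / C₀) ^ 2 * C₀) / C₀ := by
  subst h₀ h₁ h₂
  field_simp

/-- ★ **THE CENTRED FORM OF THE RATIO**: with `w`, `w·g`, `w·g²` integrable, `(C₂ − 2mC₁ + m²C₀)∕C₀ = (∫ (g − m)²·w) ∕ (∫ w)`, `C_k := ∫ g^k·w`, `m := C₁∕C₀`.
[folklore] -/
theorem ratio_eq_integral_centred_sq {Z : Type*} [MeasurableSpace Z] (τ : Measure Z) {g w : Z → ℝ}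
    (hi₀ : Integrable w τ) (hi₁ : Integrable (fun z => g z * w z) τ) (hi₂ : Integrable (fun z => g z ^ 2 * w z) τ) :
    ((∫ z, g z ^ 2 * w z ∂τ) - 2 * ((∫ z, g z * w z ∂τ) / (∫ z, w z ∂τ)) * (∫ z, g z * w z ∂τ)
        + ((∫ z, g z * w z ∂τ) / (∫ z, w z ∂τ)) ^ 2 * (∫ z, w z ∂τ)) / (∫ z, w z ∂τ)
      = (∫ z, (g z - (∫ z', g z' * w z' ∂τ) / (∫ z', w z' ∂τ)) ^ 2 * w z ∂τ) / (∫ z, w z ∂τ) := by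
  generalize (∫ z', g z' * w z' ∂τ) / (∫ z', w z' ∂τ) = m
  congr 1
  have hint : ∀ z, (g z - m) ^ 2 * w z = g z ^ 2 * w z - 2 * m * (g z * w z) + m ^ 2 * w z := by intro z; ring
  have iA : Integrable (fun z => g z ^ 2 * w z - 2 * m * (g z * w z)) τ := hi₂.sub (hi₁.const_mul _)
  rw [integral_congr_ae (Filter.Eventually.of_forall hint), integral_add iA (hi₀.const_mul _),
    integral_sub hi₂ (hi₁.const_mul _), integral_const_mul, integral_const_mul]

end Summit.QuantumFields.YangMills.Theorems.OrganTangentTiltedVarianceRatio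

end
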